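import Summits.HodgeConjecture.HodgeConjecture.Cruxes.BlochSeedDiscOne.ShellThreeDoorB

/-!
# FamilyLemmaLs — the general-shell family lemmas (L1)ₛ, (L2)ₛ (extremal g21, 2026-08-31; R19.727 (2))

Director-hodge R19.727 (2) commissioned «family door lemmas at general shell s».  This leaf types and PROVES the two
that the kernel door of `ShellThreeDoorB` (plan-lens-HodgeAV-dual g16) actually supports at every shell, by running its
(L2) → (L1) chase with `3 ↦ s`:

* `RingLe s D`  — every supported letter has co-level `≤ s` (verbatim the body of `DeepLayerLaws.RingLe s D`;
  `RingLe 3 = ShellThreeDoorB.Ring3` definitionally, see `ringLe_three_iff`);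
* `NoHook s D` — **the binder**: no HUB-FREE supported P cell contains a letter of co-level `s` (at `s = 3` it follows from
  gs-eng-2 (B) = `HubfreePB`, whose first clause gives co-level `≤ 2`, see `noHook_of_hubfreePB`; in general it follows from
  the strict regime «hub-free P ⊆ {u⁴, Auuu}»; it does NOT follow from the off-axis-only binder (M2ₛ): the axis deep hooks
  `Euuu`, `Juuu`, … violate it);
* `noN_colS_oneHub`  = (L1)ₛ: no supported N cell with a hub at `j`, a co-level-`s` letter at `k ≠ j`, every letter off `j` charged;
* `noP_off_colS_hub` = (L2)ₛ: no supported P cell with an off-axis letter at `k`, a co-level-`s` letter at `l ≠ k`, a hub at `j`,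
  every letter off `j` charged;
* `noN_col3_oneHub'` ∕ `noP_off2_col3_hub'` recover the kernel (L1)∕(L2) as the `s = 3` instances;
* (RESULT-4) `OffLow` = gs-eng-2 (B) second clause displayed alone; (L3)ₛ `noN_colPred_off_hub`, (L4)ₛ `noN_off_colS_HH`,
  (L5)ₛ `noP_colPred_off_off_hub` (the rest of the kernel door with `2 ↦ s - 1`, `3 ↦ s`), kernel (L3)∕(L4)∕(L5) recovered at `s = 3`.

SCOPE (memo `SHELL4-DOOR-BURDEN-extremal-g21.md` §9): the (L2)ₛ family is «off-axis letter strictly BELOW the ceiling + a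
DISTINCT letter AT the ceiling + hub + charged rest».  The director's (F-K) core family at `s ≥ 4` (CCGH, CCFH, ACGH, ACFH,
AAGH, AAFH, CGHu, CFHu, GGHH; and the revived trio CCDH, ACDH, BCCH) has its off-axis letter AT the ceiling with axis letters
strictly below, so it is OUTSIDE this family, and the complete (M1)(M2)-seeded coarse Rule-D cascade keeps all of it alive at
`s = 4, 5` (memo §9, `gfp4s.py`).  Nothing here is a statement about sheaves, seeds, 18881, H2 or HC: letter-model lemmas
under the displayed binders `RuleD`, `Disj`, `OnAlphabet`, `RingLe s`, `NoHook s`.  0 sorry.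
-/

namespace Summit.HodgeConjecture.HodgeConjecture.Cruxes.BlochSeedDiscOne.FamilyLemmaLs

open Summit.HodgeConjecture.HodgeConjecture.Cruxes.BlochSeedDiscOne.DepthBoundA4
open Summit.HodgeConjecture.HodgeConjecture.Cruxes.BlochSeedDiscOne.RingFourEmpty
open Summit.HodgeConjecture.HodgeConjecture.Cruxes.BlochSeedDiscOne.RingTwoMassLaw
open Summit.HodgeConjecture.HodgeConjecture.Cruxes.BlochSeedDiscOne.LeggedFloor
open Summit.HodgeConjecture.HodgeConjecture.Cruxes.BlochSeedDiscOne.ShellThreeDoorB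

/-- ring `s` of the register: every supported letter has co-level `≤ s` (body of `DeepLayerLaws.RingLe s D`). -/
def RingLe (s : ℤ) (D : Design) : Prop := ∀ x ∈ D.suppN ++ D.suppP, ∀ f : Fin 4, (x f).colevel ≤ s

/-- **NoHookₛ** — the binder of the family: no hub-free supported P cell contains a letter of co-level `s`. -/
def NoHook (s : ℤ) (D : Design) : Prop :=
  ∀ x ∈ D.suppP, (∀ f : Fin 4, (x f).colevel ≠ 0) → ∀ f : Fin 4, (x f).colevel ≠ s

theorem ringLe_three_iff (D : Design) : RingLe 3 D ↔ Ring3 D := Iff.rfl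

/-- at shell 3 the binder is implied by gs-eng-2 (B) (`HubfreePB`: hub-free P cells have all co-levels `≤ 2`); more generally
(B) gives `NoHook s` for every `s ≥ 3`. -/
theorem noHook_of_hubfreePB {D : Design} (hB : HubfreePB D) {s : ℤ} (hs : 3 ≤ s) : NoHook s D := by
  intro x hx hfree f hf
  have h2 := (hB x hx hfree).1 f
  omega

/-- the strict regime as a binder: every hub-free supported P cell has all co-levels `≤ 2` (u⁴, Auuu, AAuu, … — in
particular hub-free P ⊆ {u⁴, Auuu}) gives `NoHook s` for every `s ≥ 3`. -/
theorem noHook_of_colLeTwo {D : Design}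
    (h2 : ∀ x ∈ D.suppP, (∀ f : Fin 4, (x f).colevel ≠ 0) → ∀ f : Fin 4, (x f).colevel ≤ 2) {s : ℤ} (hs : 3 ≤ s) :
    NoHook s D := by
  intro x hx hfree f hf
  have := h2 x hx hfree f
  omega

/-- `RingLe` is monotone in `s`. -/
theorem ringLe_mono {s t : ℤ} (hst : s ≤ t) {D : Design} (hS : RingLe s D) : RingLe t D :=
  fun x hx f => (hS x hx f).trans hst

/-- **(L1)ₛ** no supported N cell with a hub at `j`, a co-level-`s` letter at `k`, and every letter off `j` charged
(block `{k, j}`: the P supplier keeps the co-level-`s` letter — it cannot lift it inside `RingLe s` — and moves the hub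
(`Disj`), so it is hub-free with a co-level-`s` letter: ¬`NoHook s`).  Kernel (L1) = the case `s = 3`. -/
theorem noN_colS_oneHub {h s : ℤ} {D : Design} (hD : D.OnAlphabet h) (hr : RuleD D) (hdis : Disj D) (hS : RingLe s D)
    (hB : NoHook s D) {y : Cell} (hy : y ∈ D.suppN) {k j : Fin 4} (hkj : k ≠ j) (hk : (y k).colevel = s)
    (hj : (y j).colevel = 0) (hch : ∀ f : Fin 4, f ≠ j → (y f).colevel ≠ 0) : False := by
  have hyA : ∀ f : Fin 4, (y f).OnAlphabet h := hD y (LeggedFloor.mem_supp_of_memN D hy)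
  obtain ⟨x, hx, hs⟩ := ruleDN_any hr hy hkj (detects_of_col_ne_zero y k j (hch k hkj))
  have hxA : ∀ f : Fin 4, (x f).OnAlphabet h := hD x (LeggedFloor.mem_supp_of_memP D hx)
  have hxk : x k = y k := by
    rcases hs.2.1 with he | hn
    · exact he
    · exfalso
      have h1 := col_lt_of_nullStep (hxA k) (hyA k) hn
      have h2 := hS x (LeggedFloor.mem_supp_of_memP D hx) k
      omega
  have hnj : NullStep (x j) (y j) := by
    rcases hs.2.2 with he | hn
    · exact (hdis x (by rw [ShellThreeDoorB.cell_eq_of_supplies hs hxk he]; exact hy) hx).elim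
    · exact hn
  have hxj : (x j).colevel ≠ 0 := by
    have h1 := col_lt_of_nullStep (hxA j) (hyA j) hnj
    have h2 := col_nonneg (y j)
    omega
  have hxfree : ∀ f : Fin 4, (x f).colevel ≠ 0 := by
    intro f
    by_cases hfk : f = k
    · rw [hfk, hxk]; exact hch k hkj
    by_cases hfj : f = j
    · rw [hfj]; exact hxj
    · rw [hs.1 f hfk hfj]; exact hch f hfj
  exact hB x hx hxfree k (by rw [hxk, hk])

/-- **(L2)ₛ** no supported P cell with an off-axis letter at `k`, a co-level-`s` letter at `l ≠ k`, a hub at `j`, and every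
letter off `j` charged (block `{k, j}`: the N consumer keeps the hub, lifts the `k` letter to a CHARGED letter — an
off-axis letter never null-steps to the hub — keeps the co-level-`s` letter at `l`, and is an (L1)ₛ cell).  Kernel (L2) =
the case `s = 3` (P BDHu, BCHu, DDHu, CDHu, BBDH, ABDH, …); at `s = 4` the family is P ADEH, ABEH, BBEH, BEHu, ADFH, ADGH,
ABFH, ABGH, BBFH, BBGH, DFHu, DGHu, DEHu, … (all dead in the strict-seeded shell-4 cascade, memo §9) — NOT CCGH∕CCFH∕…. -/
theorem noP_off_colS_hub {h s : ℤ} {D : Design} (hD : D.OnAlphabet h) (hr : RuleD D) (hdis : Disj D) (hS : RingLe s D)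
    (hB : NoHook s D) {x : Cell} (hx : x ∈ D.suppP) {k l j : Fin 4} (hkj : k ≠ j) (hlj : l ≠ j) (hkl : k ≠ l)
    (hko : OffAxis (x k)) (hls : (x l).colevel = s) (hj0 : (x j).colevel = 0)
    (hch : ∀ f : Fin 4, f ≠ j → (x f).colevel ≠ 0) : False := by
  have hxA : ∀ f : Fin 4, (x f).OnAlphabet h := hD x (LeggedFloor.mem_supp_of_memP D hx)
  obtain ⟨y, hy, hs⟩ := ruleDP_any hr hx hkj
    (detects_of_col_ne_zero x k j (by have := two_le_colevel_of_offAxis _ hko; omega))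
  have hyA : ∀ f : Fin 4, (y f).OnAlphabet h := hD y (LeggedFloor.mem_supp_of_memN D hy)
  have hyj : x j = y j := by
    rcases hs.2.2 with he | hn
    · exact he
    · exact absurd hn (not_nullStep_of_col_zero (hxA j) (hyA j) hj0)
  have hnk : NullStep (x k) (y k) := by
    rcases hs.2.1 with he | hn
    · exact (hdis x (by rw [ShellThreeDoorB.cell_eq_of_supplies hs he hyj]; exact hy) hx).elim
    · exact hn
  have hyk0 : (y k).colevel ≠ 0 := fun h0 => not_nullStep_hub_of_offAxis (hxA k) (hyA k) hko h0 hnk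
  refine noN_colS_oneHub hD hr hdis hS hB hy hlj ?_ ?_ ?_
  · rw [← hs.1 l hkl.symm hlj]; exact hls
  · rw [← hyj]; exact hj0
  · intro f hfj
    by_cases hfk : f = k
    · rw [hfk]; exact hyk0
    · rw [← hs.1 f hfk hfj]; exact hch f hfj

/-- kernel (L1) recovered as the `s = 3` instance. -/
theorem noN_col3_oneHub' {h : ℤ} {D : Design} (hD : D.OnAlphabet h) (hr : RuleD D) (hdis : Disj D) (h3 : Ring3 D)
    (hB : HubfreePB D) {y : Cell} (hy : y ∈ D.suppN) {k j : Fin 4} (hkj : k ≠ j) (hk : (y k).colevel = 3)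
    (hj : (y j).colevel = 0) (hch : ∀ f : Fin 4, f ≠ j → (y f).colevel ≠ 0) : False :=
  noN_colS_oneHub hD hr hdis ((ringLe_three_iff D).mpr h3) (noHook_of_hubfreePB hB le_rfl) hy hkj hk hj hch

/-- kernel (L2) recovered as the `s = 3` instance. -/
theorem noP_off2_col3_hub' {h : ℤ} {D : Design} (hD : D.OnAlphabet h) (hr : RuleD D) (hdis : Disj D) (h3 : Ring3 D)
    (hB : HubfreePB D) {x : Cell} (hx : x ∈ D.suppP) {k l j : Fin 4} (hkj : k ≠ j) (hlj : l ≠ j) (hkl : k ≠ l)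
    (hko : OffAxis (x k)) (hl3 : (x l).colevel = 3) (hj0 : (x j).colevel = 0)
    (hch : ∀ f : Fin 4, f ≠ j → (x f).colevel ≠ 0) : False :=
  noP_off_colS_hub hD hr hdis ((ringLe_three_iff D).mpr h3) (noHook_of_hubfreePB hB le_rfl) hx hkj hlj hkl hko hl3 hj0 hch

/-- the (F-K) non-instance, recorded as arithmetic: in the core family at shell `s ≥ 4` the letter at the ceiling IS the
off-axis letter and every other charged letter has co-level `< s`, so the hypothesis pattern of `noP_off_colS_hub`
(`OffAxis (x k)`, `(x l).colevel = s`, `k ≠ l`) has no instance on such a cell: if the only co-level-`s` slot is `k`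
itself, no `l ≠ k` with `(x l).colevel = s` exists. -/
theorem no_instance_of_unique_ceiling {s : ℤ} {x : Cell} {k : Fin 4}
    (huniq : ∀ f : Fin 4, (x f).colevel = s → f = k) {l : Fin 4} (hkl : k ≠ l) (hls : (x l).colevel = s) : False :=
  hkl (huniq l hls).symm

/-! ### (L3)ₛ, (L4)ₛ, (L5)ₛ — the rest of the kernel door at general shell `s` (extremal g21, RESULT-4)

The kernel's (L3), (L5) use the SECOND clause of gs-eng-2 (B) («an off-axis letter in a hub-free P cell forces every other
letter to co-level `≤ 1`»); we display it on its own as `OffLow` (it is `s`-independent; in the strict regime it holds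
vacuously, `offLow_of_noOffAxis`).  With it the whole five-lemma door runs at every shell `s ≥ 3`:
(L3)ₛ `noN_colPred_off_hub`, (L4)ₛ `noN_off_colS_HH`, (L5)ₛ `noP_colPred_off_off_hub`.  Instances at `s = 4` (all DEAD in
the strict-seeded coarse cascade `gfp4s.py --seed strict`, alive types of each family in the unseeded room in brackets):
(L3)₄ N «C∕D + off-axis + hub + charged» [ABCH ABDH ACDH ADDH BBCH BBDH BCHu BDHu CDHu DDHu], (L4)₄ N «off-axis + E∕F∕G + H + H»
[BEHH BFHH BGHH DEHH DFHH DGHH], (L5)₄ P «C∕D + off-axis + off-axis + hub» [BBCH BBDH BCDH BDDH CDDH DDDH]. -/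

/-- gs-eng-2 (B), second clause, as a displayed binder: in a HUB-FREE supported P cell an off-axis letter forces every
other letter to co-level `≤ 1`. -/
def OffLow (D : Design) : Prop :=
  ∀ x ∈ D.suppP, (∀ f : Fin 4, (x f).colevel ≠ 0) → ∀ k g : Fin 4, k ≠ g → OffAxis (x k) → (x g).colevel ≤ 1

theorem offLow_of_hubfreePB {D : Design} (hB : HubfreePB D) : OffLow D :=
  fun x hx hfree => (hB x hx hfree).2

/-- the strict regime gives `OffLow` vacuously: no hub-free supported P cell has an off-axis letter at all. -/
theorem offLow_of_noOffAxis {D : Design}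
    (hno : ∀ x ∈ D.suppP, (∀ f : Fin 4, (x f).colevel ≠ 0) → ∀ k : Fin 4, ¬ OffAxis (x k)) : OffLow D :=
  fun x hx hfree k _ _ hko => absurd hko (hno x hx hfree k)

/-- **(L3)ₛ** (`3 ≤ s`) no supported N cell with a co-level-`(s-1)` letter at `i`, an off-axis letter at `k`, a hub at
`j`, and every letter off `j` charged (block `{i, j}`: a supplier keeping the hub drops the `i` letter to co-level `s` —
an (L2)ₛ cell; a supplier moving the hub is hub-free with an off-axis letter next to a letter of co-level `≥ s - 1 ≥ 2`:
¬`OffLow`).  Kernel (L3) = the case `s = 3`. -/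
theorem noN_colPred_off_hub {h s : ℤ} {D : Design} (hD : D.OnAlphabet h) (hr : RuleD D) (hdis : Disj D)
    (hS : RingLe s D) (hB : NoHook s D) (hO : OffLow D) (hs3 : 3 ≤ s) {y : Cell} (hy : y ∈ D.suppN) {i k j : Fin 4}
    (hij : i ≠ j) (hkj : k ≠ j) (hik : i ≠ k) (hi : (y i).colevel = s - 1) (hko : OffAxis (y k))
    (hj0 : (y j).colevel = 0) (hch : ∀ f : Fin 4, f ≠ j → (y f).colevel ≠ 0) : False := by
  have hyA : ∀ f : Fin 4, (y f).OnAlphabet h := hD y (LeggedFloor.mem_supp_of_memN D hy)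
  obtain ⟨x, hx, hs⟩ := ruleDN_any hr hy hij (detects_of_col_ne_zero y i j (by rw [hi]; omega))
  have hxA : ∀ f : Fin 4, (x f).OnAlphabet h := hD x (LeggedFloor.mem_supp_of_memP D hx)
  have hxk : x k = y k := hs.1 k hik.symm hkj
  have hxko : OffAxis (x k) := by rw [hxk]; exact hko
  rcases hs.2.2 with hej | hnj
  · have hni : NullStep (x i) (y i) := by
      rcases hs.2.1 with he | hn
      · exact (hdis x (by rw [ShellThreeDoorB.cell_eq_of_supplies hs he hej]; exact hy) hx).elim
      · exact hn
    have hxi : (x i).colevel = s := by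
      have h1 := col_lt_of_nullStep (hxA i) (hyA i) hni
      have h2 := hS x (LeggedFloor.mem_supp_of_memP D hx) i
      omega
    refine noP_off_colS_hub hD hr hdis hS hB hx hkj hij hik.symm hxko hxi (by rw [hej]; exact hj0) ?_
    intro f hfj
    by_cases hfi : f = i
    · rw [hfi, hxi]; omega
    · rw [hs.1 f hfi hfj]; exact hch f hfj
  · have hxj0 : (x j).colevel ≠ 0 := by
      have h1 := col_lt_of_nullStep (hxA j) (hyA j) hnj
      have h2 := col_nonneg (y j)
      omega
    have hxi2 : s - 1 ≤ (x i).colevel := by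
      have h1 := col_le_of_eq_or_null (hxA i) (hyA i) hs.2.1
      omega
    have hxfree : ∀ f : Fin 4, (x f).colevel ≠ 0 := by
      intro f
      by_cases hfi : f = i
      · rw [hfi]; omega
      by_cases hfj : f = j
      · rw [hfj]; exact hxj0
      · rw [hs.1 f hfi hfj]; exact hch f hfj
    have h4 := hO x hx hxfree k i hik.symm hxko
    omega

/-- **(L4)ₛ** no supported N cell with an off-axis letter at `k`, a co-level-`s` letter at `l`, and hubs at `j` and `g`
(block `{l, j}`: the supplier keeps the co-level-`s` letter — it cannot lift it inside `RingLe s` — moves the hub at `j`,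
and is an (L2)ₛ cell with hub `g`).  Kernel (L4) = the case `s = 3`. -/
theorem noN_off_colS_HH {h s : ℤ} {D : Design} (hD : D.OnAlphabet h) (hr : RuleD D) (hdis : Disj D) (hS : RingLe s D)
    (hB : NoHook s D) {y : Cell} (hy : y ∈ D.suppN) {k l j g : Fin 4} (hkl : k ≠ l) (hkj : k ≠ j) (hkg : k ≠ g)
    (hlj : l ≠ j) (hlg : l ≠ g) (hjg : j ≠ g) (hko : OffAxis (y k))
    (hls : (y l).colevel = s) (hj0 : (y j).colevel = 0) (hg0 : (y g).colevel = 0) : False := by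
  have hyA : ∀ f : Fin 4, (y f).OnAlphabet h := hD y (LeggedFloor.mem_supp_of_memN D hy)
  have hs2 : 2 ≤ s := by
    have h1 := two_le_colevel_of_offAxis _ hko
    have h2 := hS y (LeggedFloor.mem_supp_of_memN D hy) k
    omega
  obtain ⟨x, hx, hs⟩ := ruleDN_any hr hy hlj (detects_of_col_ne_zero y l j (by rw [hls]; omega))
  have hxA : ∀ f : Fin 4, (x f).OnAlphabet h := hD x (LeggedFloor.mem_supp_of_memP D hx)
  have hxl : x l = y l := by
    rcases hs.2.1 with he | hn
    · exact he
    · exfalso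
      have h1 := col_lt_of_nullStep (hxA l) (hyA l) hn
      have h2 := hS x (LeggedFloor.mem_supp_of_memP D hx) l
      omega
  have hnj : NullStep (x j) (y j) := by
    rcases hs.2.2 with he | hn
    · exact (hdis x (by rw [ShellThreeDoorB.cell_eq_of_supplies hs hxl he]; exact hy) hx).elim
    · exact hn
  have hxj0 : (x j).colevel ≠ 0 := by
    have h1 := col_lt_of_nullStep (hxA j) (hyA j) hnj
    have h2 := col_nonneg (y j)
    omega
  have hxk : x k = y k := hs.1 k hkl hkj
  have hxg : x g = y g := hs.1 g hlg.symm hjg.symm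
  refine noP_off_colS_hub hD hr hdis hS hB hx hkg hlg hkl (by rw [hxk]; exact hko) (by rw [hxl]; exact hls)
    (by rw [hxg]; exact hg0) ?_
  intro f hfg
  by_cases hfl : f = l
  · rw [hfl, hxl, hls]; omega
  by_cases hfj : f = j
  · rw [hfj]; exact hxj0
  by_cases hfk : f = k
  · rw [hfk, hxk]; have := two_le_colevel_of_offAxis _ hko; omega
  exact (ShellThreeDoorB.fin4_exhaust k l j g f hkl hkj hkg hlj hlg hjg hfk hfl hfj hfg).elim

/-- **(L5)ₛ** (`3 ≤ s`) no supported P cell with a co-level-`(s-1)` letter at `i`, off-axis letters at `k` and `l`, and a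
hub at `j` (block `{l, j}`: the consumer keeps the hub, lifts the `l` letter to a charged letter, and is an (L3)ₛ cell).
Kernel (L5) = the case `s = 3`. -/
theorem noP_colPred_off_off_hub {h s : ℤ} {D : Design} (hD : D.OnAlphabet h) (hr : RuleD D) (hdis : Disj D)
    (hS : RingLe s D) (hB : NoHook s D) (hO : OffLow D) (hs3 : 3 ≤ s) {x : Cell} (hx : x ∈ D.suppP)
    {i k l j : Fin 4} (hik : i ≠ k) (hil : i ≠ l) (hij : i ≠ j) (hkl : k ≠ l) (hkj : k ≠ j) (hlj : l ≠ j)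
    (hi : (x i).colevel = s - 1) (hko : OffAxis (x k)) (hlo : OffAxis (x l)) (hj0 : (x j).colevel = 0) : False := by
  have hxA : ∀ f : Fin 4, (x f).OnAlphabet h := hD x (LeggedFloor.mem_supp_of_memP D hx)
  obtain ⟨y, hy, hs⟩ := ruleDP_any hr hx hlj
    (detects_of_col_ne_zero x l j (by have := two_le_colevel_of_offAxis _ hlo; omega))
  have hyA : ∀ f : Fin 4, (y f).OnAlphabet h := hD y (LeggedFloor.mem_supp_of_memN D hy)
  have hyj : x j = y j := by
    rcases hs.2.2 with he | hn
    · exact he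
    · exact absurd hn (not_nullStep_of_col_zero (hxA j) (hyA j) hj0)
  have hnl : NullStep (x l) (y l) := by
    rcases hs.2.1 with he | hn
    · exact (hdis x (by rw [ShellThreeDoorB.cell_eq_of_supplies hs he hyj]; exact hy) hx).elim
    · exact hn
  have hyl0 : (y l).colevel ≠ 0 := fun h0 => not_nullStep_hub_of_offAxis (hxA l) (hyA l) hlo h0 hnl
  have hyi : x i = y i := hs.1 i hil hij
  have hyk : x k = y k := hs.1 k hkl hkj
  refine noN_colPred_off_hub hD hr hdis hS hB hO hs3 hy hij hkj hik (by rw [← hyi]; exact hi)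
    (by rw [← hyk]; exact hko) (by rw [← hyj]; exact hj0) ?_
  intro f hfj
  by_cases hfi : f = i
  · rw [hfi, ← hyi, hi]; omega
  by_cases hfk : f = k
  · rw [hfk, ← hyk]; have := two_le_colevel_of_offAxis _ hko; omega
  by_cases hfl : f = l
  · rw [hfl]; exact hyl0
  exact (ShellThreeDoorB.fin4_exhaust i k l j f hik hil hij hkl hkj hlj hfi hfk hfl hfj).elim

/-- kernel (L3) recovered as the `s = 3` instance. -/
theorem noN_col2_off2_hub' {h : ℤ} {D : Design} (hD : D.OnAlphabet h) (hr : RuleD D) (hdis : Disj D) (h3 : Ring3 D)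
    (hB : HubfreePB D) {y : Cell} (hy : y ∈ D.suppN) {i k j : Fin 4} (hij : i ≠ j) (hkj : k ≠ j) (hik : i ≠ k)
    (hi2 : (y i).colevel = 2) (hko : OffAxis (y k)) (hj0 : (y j).colevel = 0)
    (hch : ∀ f : Fin 4, f ≠ j → (y f).colevel ≠ 0) : False :=
  noN_colPred_off_hub hD hr hdis ((ringLe_three_iff D).mpr h3) (noHook_of_hubfreePB hB le_rfl) (offLow_of_hubfreePB hB)
    le_rfl hy hij hkj hik (by rw [hi2]; norm_num) hko hj0 hch

/-- kernel (L4) recovered as the `s = 3` instance. -/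
theorem noN_col3_off2_HH' {h : ℤ} {D : Design} (hD : D.OnAlphabet h) (hr : RuleD D) (hdis : Disj D) (h3 : Ring3 D)
    (hB : HubfreePB D) {y : Cell} (hy : y ∈ D.suppN) {k l j g : Fin 4} (hkl : k ≠ l) (hkj : k ≠ j) (hkg : k ≠ g)
    (hlj : l ≠ j) (hlg : l ≠ g) (hjg : j ≠ g) (hko : OffAxis (y k))
    (hl3 : (y l).colevel = 3) (hj0 : (y j).colevel = 0) (hg0 : (y g).colevel = 0) : False :=
  noN_off_colS_HH hD hr hdis ((ringLe_three_iff D).mpr h3) (noHook_of_hubfreePB hB le_rfl) hy hkl hkj hkg hlj hlg hjg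
    hko hl3 hj0 hg0

/-- kernel (L5) recovered as the `s = 3` instance. -/
theorem noP_col2_off2_off2_hub' {h : ℤ} {D : Design} (hD : D.OnAlphabet h) (hr : RuleD D) (hdis : Disj D) (h3 : Ring3 D)
    (hB : HubfreePB D) {x : Cell} (hx : x ∈ D.suppP) {i k l j : Fin 4} (hik : i ≠ k) (hil : i ≠ l) (hij : i ≠ j)
    (hkl : k ≠ l) (hkj : k ≠ j) (hlj : l ≠ j) (hi2 : (x i).colevel = 2) (hko : OffAxis (x k))
    (hlo : OffAxis (x l)) (hj0 : (x j).colevel = 0) : False :=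
  noP_colPred_off_off_hub hD hr hdis ((ringLe_three_iff D).mpr h3) (noHook_of_hubfreePB hB le_rfl)
    (offLow_of_hubfreePB hB) le_rfl hx hik hil hij hkl hkj hlj (by rw [hi2]; norm_num) hko hlo hj0

end Summit.HodgeConjecture.HodgeConjecture.Cruxes.BlochSeedDiscOne.FamilyLemmaLs
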